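import Literature.NumberTheory.IwasawaTheory.ClassGroupPRankLeOfRelationTwoRamified
import Literature.NumberTheory.IwasawaTheory.ClassGroupPRankLeOfRelationTwoLayer
import Literature.NumberTheory.EllipticCurves.ZpExtensionLayersLocalSymbolProofs
import HarnessLib

/-!
# THE RELATION DOOR at `p = 2`, ANY LAYER `K_n` (`n ≥ 1`), ANY UNIT DEPTH: `K` of odd degree with `2 ∤ d_K`, exactly two dyadic primes, `2 ∤ h_K`,
# units `≡ ±1 (mod 𝔭₁³)`, the genus certificate for `N_{K_n/K_1}(c)` and ONE relation of order `d ≤ 2^n − 2` ⟹ `rank₂ ≤ d`, `μ₂ = 0`, `λ₂ ≤ d`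
# — WITHOUT the non-norm unit hypothesis `ε^{2^{n−2}} ∉ N_{K_n/K}` of att-p3 g48's door

Topic `NumberTheory/IwasawaTheory` (namespace = path).  THEOREMS ONLY (no definition, no named fact, no instance, no `sorry`); unconditional.  Written by the prover seat
`bsd-line-att-p3` g49 (cell `bsd-f1-sign2`, WIDTH-5 attach on route `AlignedTransportAtTwo`, crux C2 stmt-BirchSwinnertonDyer-22298; `--supports`, closes nothing).
This is att-p3 g48's `classicalMuVanishes_two_of_relation_of_genusCert_layer` (`ClassGroupPRankLeOfRelationTwoLayer.lean`) with the DISPLAYED hypothesis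
`hnot : ε^{2^j} ∉ N_{K_{j+2}/K} K_{j+2}ˣ` REMOVED — not discharged case by case (g49's level-`32` lemma does that for `t = 3`, `j = 1`), but made unnecessary by genus
theory: over such a base the `Gal(K_n/K)`-coinvariants of `Cl(K_n)/2` are cyclic for EVERY unit depth `t` (this seat's `NumberFields/GenusCoinvariantCyclicOfTwoRamified` +
`IwasawaTheory/ClassGroupPRankLeOfRelationTwoRamified`).  HABITAT (cell bsd-f1-sign2, crux C2, `K = ℚ(β)` complex cubic, `Δ_W ≡ 5 (8)`, `h_K` odd): ALL of
`t = 3` (hard core `N = 1259, 3027, 3523, 9139, 14891`) AND the converse quadrant `t ≥ 4 ∧ e₁ ≥ 2` (`N = 1187, 4307, 13971, 14539`), where no door fired before.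

* ★★★ `classicalMuVanishes_two_of_relation_of_genusCert_layer_anyDepth` — `K` odd degree, `2 ∤ d_K`, `κ` cyclotomic, exactly two primes above `2`, `2 ∤ h_K`; `𝔭₁ ∋ 2`
  maximal with `𝓞_K/𝔭₁ = 𝔽₂`; every unit `≡ ±1 (mod 𝔭₁³)` (i.e. `t ≥ 3`); a class `c ∈ Cl(K_m)` (`m ≥ 1`) with the GENUS CERTIFICATE `(𝔄, k, π)` for `N_{K_m/K_1}(c)`;
  `σ` generating `Gal(K_m/K)`; ONE RELATION `∏ σ^i(c)^{f_i} = 1` with `∑ f_i X^i = (X−1)^d·u + 2·g`, `u(1)` odd, `d + 2 ≤ 2^m`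
  ⟹ `rank₂ Cl(K_l) ≤ d ∀ l`, `μ₂(κ) = 0`, `λ₂(κ) ≤ d`.

HONEST SCOPE: classical; nothing specific to any summit; no certificate for any field is asserted; BSD is not advanced by this file.

## References

* L. C. Washington, *Introduction to Cyclotomic Fields*, 2nd ed. (1997), §13.1 Prop. 13.2, §13.3 Lemmas 13.15, 13.18, Prop. 13.22–13.23. [Washington1997]
* G. Gras, *Class Field Theory* (2003), IV.4. [Gras2003]
* S. Lang, *Cyclotomic Fields I and II* (1990), Ch. 13 §4 Lemma 4.1. [Lang1990]
* T. Fukuda, *Remarks on `ℤ_p`-extensions of number fields*, Proc. Japan Acad. 70 A (1994), Thm. 1. [Fukuda1994]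
* J. Neukirch, *Algebraic Number Theory* (1999), Ch. III (2.12), Ch. I §9 (9.6). [NeukirchANT1999]
-/

set_option autoImplicit false

noncomputable section

open scoped NumberField nonZeroDivisors
open NumberField IsDedekindDomain Field Polynomial Finset

namespace Literature.NumberTheory.IwasawaTheory

open Literature.NumberTheory.EllipticCurves Literature.NumberTheory.NumberFields Literature.NumberTheory.NumberFields.AmbiguousClass
  Literature.NumberTheory.GaloisRepresentations

section Layer

variable {K : Type} [Field K] [NumberField K]

set_option maxHeartbeats 800000 in
/-- ★★★ **THE RELATION DOOR AT `p = 2`, ANY LAYER, ANY UNIT DEPTH, FROM BASE-FIELD DATA.**  `K` of odd degree with `2 ∤ d_K` and exactly two primes above `2`, `κ` a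
cyclotomic `ℤ₂`-extension, `2 ∤ h_K`; `𝔭₁ ∋ 2` maximal with `𝓞_K/𝔭₁ = 𝔽₂`; every unit `≡ ±1 (mod 𝔭₁³)`; a class `c ∈ Cl(K_m)`, `1 ≤ m`, with the GENUS CERTIFICATE
`(𝔄, k, π)` (`N_{K_m/K_1}(c) = [𝔄]`, `N_{K_1/K}(𝔄)^k = (π)`, `π ≡ ±3 (mod 𝔭₁³)`); `σ` a generator of `Gal(K_m/K)`; ONE RELATION `∏_{i<N} σ^i(c)^{f_i} = 1` with
`∑ f_i X^i = (X−1)^d·u + 2·g`, `u(1)` odd, **`d + 2 ≤ 2^m`**.  THEN **`rank₂ Cl(K_l) ≤ d` for every `l`, `μ₂(κ) = 0`, `λ₂(κ) ≤ d`** — no hypothesis on the `2`-adic depth of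
the units beyond `t ≥ 3` (the coinvariants of `Cl(K_m)/2` are cyclic by genus theory: `h_K` odd, the two dyadic primes totally ramified, nothing else ramified).
[cite: Washington1997, §13.1 Prop. 13.2, §13.3 Prop. 13.22–13.23] [cite: Gras2003, IV.4] [cite: Lang1990, Ch. 13 §4 Lemma 4.1] [cite: Fukuda1994, Thm. 1, p. 264]
[cite: NeukirchANT1999, Ch. III (2.12)] -/
theorem classicalMuVanishes_two_of_relation_of_genusCert_layer_anyDepth (hK2 : ¬ 2 ∣ Module.finrank ℚ K) (hd : ¬ (2 : ℤ) ∣ NumberField.discr K)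
    (κ : ZpExtension K 2) (hκ : κ.IsCyclotomic)
    (h2card : {w : HeightOneSpectrum (𝓞 K) | ((2 : ℕ) : 𝓞 K) ∈ w.asIdeal}.ncard = 2)
    (hh : ¬ 2 ∣ classNumber K) {m : ℕ} (hm : 1 ≤ m)
    [NumberField (κ.layer 1)] [NumberField (κ.layer m)] [Algebra (κ.layer 1) (κ.layer m)]
    [IsScalarTower K (κ.layer 1) (κ.layer m)]
    (P : Ideal (𝓞 K)) [P.IsMaximal] (hres : ∀ r : 𝓞 K, r ∈ P ∨ r - 1 ∈ P) (h2P : (2 : 𝓞 K) ∈ P)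
    (hunits : ∀ u : (𝓞 K)ˣ, (u : 𝓞 K) - 1 ∈ P ^ 3 ∨ (u : 𝓞 K) + 1 ∈ P ^ 3)
    {π : 𝓞 K} (hπ : π - 3 ∈ P ^ 3 ∨ π + 3 ∈ P ^ 3)
    {A : Ideal (𝓞 (κ.layer 1))} (hA0 : A ≠ ⊥) {k : ℕ} (hA : Ideal.relNorm (𝓞 K) A ^ k = Ideal.span {π})
    (σ : (κ.layer m) ≃ₐ[K] (κ.layer m)) (hσ : ∀ τ : (κ.layer m) ≃ₐ[K] (κ.layer m), τ ∈ Subgroup.zpowers σ)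
    {c : ClassGroup (𝓞 (κ.layer m))}
    (hcA : classGroupNorm (κ.layer 1) (κ.layer m) c = ClassGroup.mk0 ⟨A, mem_nonZeroDivisors_of_ne_zero hA0⟩)
    {N d : ℕ} (hd2 : d + 2 ≤ 2 ^ m) {f : ℕ → ℤ} {u g : ℤ[X]} (hu : ¬ (2 : ℤ) ∣ u.eval 1)
    (hF : (∑ i ∈ range N, C (f i) * X ^ i : ℤ[X]) = (X - 1) ^ d * u + C (2 : ℤ) * g)
    (hrel : ∏ i ∈ range N, (ClassGroup.mulEquiv (intAut (σ ^ i)) c) ^ (f i) = 1) :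
    (∀ l, classGroupPRank κ l ≤ d) ∧ ClassicalMuVanishes κ ∧ classicalLambda κ ≤ d := by
  classical
  haveI : Fact (Nat.Prime 2) := ⟨Nat.prime_two⟩
  haveI : FiniteDimensional K (κ.layer m) := κ.finiteDimensional_layer_holds m
  haveI : IsGalois K (κ.layer m) := κ.isGalois_layer_holds m
  have hodd := forall_odd_ramificationIdx_of_not_dvd_discr hd
  have hκ0 : TotallyRamifiedFrom κ 0 := totallyRamifiedFrom_zero_of_forall_odd_ramificationIdx hK2 κ hκ hodd
  -- the generator certificate
  have hc := not_exists_eq_conj_div_mul_sq_of_genusCert_layer hK2 hd κ hκ hh m P hres h2P hunits hπ hA0 hA σ hcA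
  -- the two dyadic primes `P` and `P₂`
  have hP0 : P ≠ ⊥ := fun h0 => by
    rw [h0, Ideal.mem_bot] at h2P
    exact two_ne_zero h2P
  set vP : HeightOneSpectrum (𝓞 K) := ⟨P, Ideal.IsMaximal.isPrime inferInstance, hP0⟩ with hvP
  have hvPmem : vP ∈ {w : HeightOneSpectrum (𝓞 K) | ((2 : ℕ) : 𝓞 K) ∈ w.asIdeal} := by
    change ((2 : ℕ) : 𝓞 K) ∈ P
    exact_mod_cast h2P
  obtain ⟨w₁, w₂, hne, hset⟩ := Set.ncard_eq_two.mp h2card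
  obtain ⟨vQ, hvQmem, hvQne⟩ : ∃ vQ : HeightOneSpectrum (𝓞 K), vQ ∈ {w : HeightOneSpectrum (𝓞 K) | ((2 : ℕ) : 𝓞 K) ∈ w.asIdeal} ∧ vQ ≠ vP := by
    rw [hset] at hvPmem ⊢
    rcases hvPmem with h | h
    · exact ⟨w₂, Or.inr rfl, fun h' => hne (h.symm ▸ h'.symm)⟩
    · exact ⟨w₁, Or.inl rfl, fun h' => hne (h' ▸ h.symm ▸ rfl)⟩
  -- every dyadic prime is `vP` or `vQ`
  have hdyadic : ∀ w : HeightOneSpectrum (𝓞 K), ((2 : ℕ) : 𝓞 K) ∈ w.asIdeal → w = vP ∨ w = vQ := by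
    intro w hw
    have hw' : w ∈ ({w₁, w₂} : Set (HeightOneSpectrum (𝓞 K))) := hset ▸ hw
    have hP' : vP ∈ ({w₁, w₂} : Set (HeightOneSpectrum (𝓞 K))) := hset ▸ hvPmem
    have hQ' : vQ ∈ ({w₁, w₂} : Set (HeightOneSpectrum (𝓞 K))) := hset ▸ hvQmem
    simp only [Set.mem_insert_iff, Set.mem_singleton_iff] at hw' hP' hQ'
    by_cases hwP : w = vP
    · exact Or.inl hwP
    · right
      rcases hw' with rfl | rfl <;> rcases hP' with hP' | hP' <;> rcases hQ' with hQ' | hQ'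
      all_goals first | exact absurd hP'.symm hwP | exact hQ'.symm | exact absurd (hQ'.trans hP'.symm) hvQne
  set P₂ : Ideal (𝓞 K) := vQ.asIdeal with hP₂
  haveI : P₂.IsMaximal := vQ.isMaximal
  -- unramified outside `P`, `P₂`
  have hram : ∀ (q : Ideal (𝓞 (κ.layer m))) [q.IsMaximal], q.under (𝓞 K) ≠ P → q.under (𝓞 K) ≠ P₂ → Algebra.IsUnramifiedAt (𝓞 K) q := by
    intro q hq h1 h2
    have hq0 : q.under (𝓞 K) ≠ ⊥ := mt Ideal.eq_bot_of_comap_eq_bot (Ring.ne_bot_of_isMaximal_of_not_isField hq (RingOfIntegers.not_isField _))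
    set w : HeightOneSpectrum (𝓞 K) := ⟨q.under (𝓞 K), Ideal.IsPrime.under (𝓞 K) q, hq0⟩ with hw
    have hw2 : ((2 : ℕ) : 𝓞 K) ∉ w.asIdeal := by
      intro h2w
      rcases hdyadic w h2w with h | h
      · exact h1 (congrArg HeightOneSpectrum.asIdeal h)
      · exact h2 (congrArg HeightOneSpectrum.asIdeal h)
    exact ZpExtension.isUnramifiedIn_layer_of_not_mem κ m hw2 q hq.isPrime ⟨rfl⟩
  -- the primes above `P` are totally ramified
  have htot : ∀ (q : Ideal (𝓞 (κ.layer m))) [q.IsMaximal], q.under (𝓞 K) = P → q.ramificationIdx (𝓞 K) = Module.finrank K (κ.layer m) := by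
    intro q hq h1
    haveI : q.LiesOver P := ⟨h1.symm⟩
    have hne1 := ramificationIdxIn_layer_ne_one_of_odd_ramificationIdx hK2 κ hκ (w := vP) (by exact_mod_cast h2P) (hodd vP hvPmem) hm
    have hpow := ramificationIdxIn_layer_eq_pow_of_ne_one κ hκ0 m hne1
    rw [← Ideal.ramificationIdxIn_eq_ramificationIdx P q ((κ.layer m) ≃ₐ[K] (κ.layer m)), κ.finrank_layer_holds m]
    exact hpow
  have hp2 : ¬ ((2 : ℕ) : ℤ) ∣ u.eval 1 := by exact_mod_cast hu
  have hF' : (∑ i ∈ range N, C (f i) * X ^ i : ℤ[X]) = (X - 1) ^ d * u + C (((2 : ℕ) : ℤ)) * g := by exact_mod_cast hF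
  exact classicalMuVanishes_and_classicalLambda_le_of_relation_of_two_ramified κ hκ0 hh P P₂ hram htot σ hσ hc (by exact_mod_cast hd2) hp2 hF' hrel

end Layer

end Literature.NumberTheory.IwasawaTheory

end
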